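import Mathlib
import Summits.Ventures.PercRepro2.HCov
import Summits.Ventures.PercRepro2.HCovSwap
import Summits.Ventures.PercRepro2.TypeRB

/-!
# The two `b`-halves of `Gc` and the SHARP reduction of (HCOV) (blind cell PercRepro2, night-1 g35)

Under `Q = {a₁ ↮ a₂}`, `L = C(a₁)`, `H = C(a₂)`, the crux functional
`G = P(Q) Cov_Q(σ_b, F) − D Cov_PD(1_{b∈U}, 1_{o∈U})` (`F = σ_o + σ₃(γ − 1_{o∈U})`, `γ = D_o/D`)
splits along `σ_b = 1_{bL} − 1_{bH}` into `Γ_L = P(Q) Cov_Q(1_{bL}, F) − D Cov_PD(1_{bL}, 1_{o∈U})`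
and its root mirror `Γ_H`; cleared, `ΓLc = D P(Q) Γ_L`, `ΓHc = D P(Q) Γ_H`:
**`Gc_eq_halves`** `Gc = ΓLc + ΓHc`, **`GammaHc_eq_swap`** (`ΓHc` = `ΓLc` with the roots exchanged).

`Γ_L = 2 P(Q) Cov_Q(1_{bL}, Ξ_γ)` with `Ξ_c = 1_{a₃∈H}(1_{o∈U} − c) − 1_{oH}`, increasing in the
centring `c` (slope `−Cov_Q(1_{bL}, 1_{a₃∈H}) ≥ 0`, BHK); the least admissible centring is
`c₀ = P(oL | T) + P(oH | R)`, `T = Q ∩ {a₃ ∈ H}` (`TEvent ends a₁ a₂ a₃`), `R = Q ∩ {a₃ ∉ H}`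
(`avoidAll ends a₂ {a₁, a₃}`), where the covariance becomes the 4-term expression
**`SL`** `= P(T,bL,oL) P(T) P(R) − P(T,bL) P(T,oL) P(R) + P(R,bL) P(R,oH) P(T) − P(R,bL,oH) P(T) P(R)`
(`= P(T) P(R) [P(T) Cov(1_{bL}, 1_{oL} | T) − P(R) Cov(1_{bL}, 1_{oH} | R)]`):
**`sharp_identity`** `P(T) P(R) ΓLc = 2 [D P(Q) SL + (D_o P(T) P(R) − D P(T,oL) P(R) − D P(R,oH) P(T)) (P(Q,bL) P(T) − P(T,bL) P(Q))]`,
the two brackets `≥ 0` by `CovForm.ToL_mul_D_le` (+ root swap) and `bhk_cross_cluster`.  Hence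
**`HCov_of_SharpL_SharpH`**: **(HCOV) ⟸ SHARP-L ∧ SHARP-H** (`SharpL := 0 ≤ SL`, SHARP-H its root
mirror) for every labelled instance, the degenerate worlds included (`P(T) = 0`: the half is a
`bhk_cross_cluster` slack; `P(R) = 0`: `D = 0` and the half vanishes); **`HCov_all_of_SharpL_all`**.

SHARP-L: the (possibly negative) membership-conditioned covariance `P(T) Cov(1_{bL}, 1_{oL} | T)` is
dominated by the avoidance-conditioned BHK slack `−P(R) Cov(1_{bL}, 1_{oH} | R) ≥ 0`.  Census (night-1
g35, own code): exact 258/258 random instances `n = 5–7` (planted control fails 93/258); the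
admissible-centring computation (Strassen / max-flow over all `σ`-increasing test functions) gives
`c* = c₀` exactly on 48/48 non-degenerate instances — SHARP-L is the sharp form of the `L`-half.
-/

namespace Summit.Ventures.PercRepro2

namespace SharpHalves

open CovForm SideBridge

section Defs

variable {V : Type*} {E : Type*} [Fintype E] [DecidableEq E] [DecidableEq V] {R : Type*}
  [Field R] [LinearOrder R]

/-- **The cleared `L`-half** `ΓLc = D · P(Q) · Γ_L`,
`Γ_L = P(Q) Cov_Q(1_{bL}, F) − D Cov_PD(1_{bL}, 1_{o∈U})`, written in the pattern masses of
`CovForm.Gc` (`D · E_Q[1_{bL} F] = D E_Q[1_{bL} σ_o] + D_o E_Q[1_{bL} σ₃] − D E_Q[1_{bL} σ₃ 1_{o∈U}]`). -/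
noncomputable def GammaLc (p : E → R) (ends : E → Sym2 V) (o a₁ a₂ a₃ b : V) : R :=
  prob p (avoidAll ends a₂ {a₁}) *
      (prob p (PDEvent ends a₁ a₂ a₃) *
          (prob p (avoidAll ends a₂ {a₁} ∩ (connEvent ends a₁ o ∩ connEvent ends a₁ b)) -
            prob p (avoidAll ends a₂ {a₁} ∩ (connEvent ends a₂ o ∩ connEvent ends a₁ b))) +
        Do p ends o a₁ a₂ a₃ *
          (prob p (TEvent ends a₂ a₁ a₃ ∩ connEvent ends a₁ b) -
            prob p (TEvent ends a₁ a₂ a₃ ∩ connEvent ends a₁ b)) -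
        prob p (PDEvent ends a₁ a₂ a₃) *
          (prob p (TEvent ends a₂ a₁ a₃ ∩ (connEvent ends a₁ o ∩ connEvent ends a₁ b)) +
            prob p (TEvent ends a₂ a₁ a₃ ∩ (connEvent ends a₂ o ∩ connEvent ends a₁ b)) -
            prob p (TEvent ends a₁ a₂ a₃ ∩ (connEvent ends a₁ o ∩ connEvent ends a₁ b)) -
            prob p (TEvent ends a₁ a₂ a₃ ∩ (connEvent ends a₂ o ∩ connEvent ends a₁ b)))) -
    prob p (avoidAll ends a₂ {a₁} ∩ connEvent ends a₁ b) * DEF p ends o a₁ a₂ a₃ -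
    prob p (avoidAll ends a₂ {a₁}) * prob p (PDEvent ends a₁ a₂ a₃) *
      (prob p (PDEvent ends a₁ a₂ a₃ ∩ (connEvent ends a₁ o ∩ connEvent ends a₁ b)) +
        prob p (PDEvent ends a₁ a₂ a₃ ∩ (connEvent ends a₂ o ∩ connEvent ends a₁ b))) +
    prob p (avoidAll ends a₂ {a₁}) * prob p (PDEvent ends a₁ a₂ a₃ ∩ connEvent ends a₁ b) *
      Do p ends o a₁ a₂ a₃

/-- **The cleared `H`-half** `ΓHc = D · P(Q) · Γ_H`, `Γ_H = −P(Q) Cov_Q(1_{bH}, F) − D Cov_PD(1_{bH}, 1_{o∈U})`: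
the `L`-half with the two roots exchanged. -/
noncomputable def GammaHc (p : E → R) (ends : E → Sym2 V) (o a₁ a₂ a₃ b : V) : R :=
  GammaLc p ends o a₂ a₁ a₃ b

/-- **`SL`**, the sharp `L`-half in the two worlds `T = Q ∩ {a₃ ∈ H}`, `R = Q ∩ {a₃ ∉ H}`:
`P(T,bL,oL) P(T) P(R) − P(T,bL) P(T,oL) P(R) + P(R,bL) P(R,oH) P(T) − P(R,bL,oH) P(T) P(R)`. -/
noncomputable def SL (p : E → R) (ends : E → Sym2 V) (o a₁ a₂ a₃ b : V) : R :=
  prob p (TEvent ends a₁ a₂ a₃ ∩ (connEvent ends a₁ o ∩ connEvent ends a₁ b)) *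
      prob p (TEvent ends a₁ a₂ a₃) * prob p (avoidAll ends a₂ {a₁, a₃}) -
    prob p (TEvent ends a₁ a₂ a₃ ∩ connEvent ends a₁ b) *
      prob p (TEvent ends a₁ a₂ a₃ ∩ connEvent ends a₁ o) * prob p (avoidAll ends a₂ {a₁, a₃}) +
    prob p (avoidAll ends a₂ {a₁, a₃} ∩ connEvent ends a₁ b) *
      prob p (avoidAll ends a₂ {a₁, a₃} ∩ connEvent ends a₂ o) * prob p (TEvent ends a₁ a₂ a₃) -
    prob p (avoidAll ends a₂ {a₁, a₃} ∩ (connEvent ends a₂ o ∩ connEvent ends a₁ b)) *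
      prob p (TEvent ends a₁ a₂ a₃) * prob p (avoidAll ends a₂ {a₁, a₃})

/-- **SHARP-L**: `0 ≤ SL`, i.e. `P(T) Cov(1_{bL}, 1_{oL} | T) ≥ P(R) Cov(1_{bL}, 1_{oH} | R)`. -/
def SharpL (p : E → R) (ends : E → Sym2 V) (o a₁ a₂ a₃ b : V) : Prop :=
  0 ≤ SL p ends o a₁ a₂ a₃ b

end Defs

section Closure

variable (R : Type*) [Field R] [LinearOrder R] [IsStrictOrderedRing R]

/-- **SHARP-L for every finite graph and every labelling** (SHARP-H is the instance with the roots
exchanged, so it is included). -/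
def SharpL_all : Prop :=
  ∀ (V E : Type) [Fintype V] [DecidableEq V] [Fintype E] [DecidableEq E]
    (ends : E → Sym2 V) (p : E → R), IsProbVec p →
    ∀ o a₁ a₂ a₃ b : V, a₁ ≠ a₂ → a₁ ≠ a₃ → a₂ ≠ a₃ → o ≠ a₁ → o ≠ a₂ → o ≠ a₃ → o ≠ b →
      b ≠ a₁ → b ≠ a₂ → b ≠ a₃ → SharpL p ends o a₁ a₂ a₃ b

end Closure

section Identities

variable {V : Type*} {E : Type*} [Fintype E] [DecidableEq E] [DecidableEq V] {R : Type*}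
  [Field R] [LinearOrder R] [IsStrictOrderedRing R]

omit [DecidableEq V] [LinearOrder R] [IsStrictOrderedRing R] in
/-- `D_o` is symmetric in the roots. -/
lemma Do_root_swap (p : E → R) (ends : E → Sym2 V) (o a₁ a₂ a₃ : V) :
    Do p ends o a₂ a₁ a₃ = Do p ends o a₁ a₂ a₃ := by
  unfold Do
  rw [PDEvent_root_swap]
  ring

omit [DecidableEq V] [LinearOrder R] [IsStrictOrderedRing R] in
/-- `D · E_Q[F]` changes sign under the root swap (`σ_o, σ₃ ↦ −σ_o, −σ₃`). -/
lemma DEF_root_swap (p : E → R) (ends : E → Sym2 V) (o a₁ a₂ a₃ : V) :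
    DEF p ends o a₂ a₁ a₃ = -DEF p ends o a₁ a₂ a₃ := by
  unfold DEF EQo EQ3 EQ3o
  rw [PDEvent_root_swap, avoidAll_root_swap, Do_root_swap]
  ring

omit [DecidableEq V] [LinearOrder R] [IsStrictOrderedRing R] in
/-- **`ΓHc` is `ΓLc` with the roots exchanged.** -/
theorem GammaHc_eq_swap (p : E → R) (ends : E → Sym2 V) (o a₁ a₂ a₃ b : V) :
    GammaHc p ends o a₁ a₂ a₃ b = GammaLc p ends o a₂ a₁ a₃ b := rfl

omit [DecidableEq V] in
/-- **`Gc = ΓLc + ΓHc`**: the crux functional is the sum of its two `b`-halves. -/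
theorem Gc_eq_halves (p : E → R) (ends : E → Sym2 V) (o a₁ a₂ a₃ b : V) :
    Gc p ends o a₁ a₂ a₃ b = GammaLc p ends o a₁ a₂ a₃ b + GammaHc p ends o a₁ a₂ a₃ b := by
  unfold Gc GammaHc GammaLc EQbo EQb3 EQb3o PDb PDbo
  rw [gap_eq_Q, PDEvent_root_swap ends a₁ a₂ a₃, avoidAll_root_swap ends a₁ a₂,
    Do_root_swap p ends o a₁ a₂ a₃, DEF_root_swap p ends o a₁ a₂ a₃]
  ring

omit [LinearOrder R] [IsStrictOrderedRing R] in
/-- `R = Q ∩ {a₃ ∉ H} = PD ⊔ T′` on any event `X`. -/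
lemma prob_R_eq (p : E → R) (ends : E → Sym2 V) (a₁ a₂ a₃ : V) (X : Set (Config E)) :
    prob p (avoidAll ends a₂ {a₁, a₃} ∩ X) =
      prob p (PDEvent ends a₁ a₂ a₃ ∩ X) + prob p (TEvent ends a₂ a₁ a₃ ∩ X) := by
  have h := ISplit.prob_PD_add_T p ends a₂ a₁ a₃ X
  rw [PDEvent_root_swap] at h
  exact h.symm

omit [LinearOrder R] [IsStrictOrderedRing R] in
/-- `P(R) = D + P(T′)`. -/
lemma prob_R_univ (p : E → R) (ends : E → Sym2 V) (a₁ a₂ a₃ : V) :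
    prob p (avoidAll ends a₂ {a₁, a₃}) =
      prob p (PDEvent ends a₁ a₂ a₃) + prob p (TEvent ends a₂ a₁ a₃) := by
  have h := prob_R_eq p ends a₁ a₂ a₃ Set.univ
  simpa only [Set.inter_univ] using h

omit [LinearOrder R] [IsStrictOrderedRing R] in
/-- **The sharp identity**:
`P(T) P(R) · ΓLc = 2 [D P(Q) · SL + (D_o P(T) P(R) − D P(T,oL) P(R) − D P(R,oH) P(T)) · (P(Q,bL) P(T) − P(T,bL) P(Q))]`. -/
theorem sharp_identity (p : E → R) (ends : E → Sym2 V) (o a₁ a₂ a₃ b : V) :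
    prob p (TEvent ends a₁ a₂ a₃) * prob p (avoidAll ends a₂ {a₁, a₃}) *
        GammaLc p ends o a₁ a₂ a₃ b =
      2 * (prob p (PDEvent ends a₁ a₂ a₃) * prob p (avoidAll ends a₂ {a₁}) *
            SL p ends o a₁ a₂ a₃ b +
          (Do p ends o a₁ a₂ a₃ * prob p (TEvent ends a₁ a₂ a₃) *
                prob p (avoidAll ends a₂ {a₁, a₃}) -
              prob p (PDEvent ends a₁ a₂ a₃) * prob p (TEvent ends a₁ a₂ a₃ ∩ connEvent ends a₁ o) *
                prob p (avoidAll ends a₂ {a₁, a₃}) -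
              prob p (PDEvent ends a₁ a₂ a₃) *
                prob p (avoidAll ends a₂ {a₁, a₃} ∩ connEvent ends a₂ o) *
                prob p (TEvent ends a₁ a₂ a₃)) *
            (prob p (avoidAll ends a₂ {a₁} ∩ connEvent ends a₁ b) * prob p (TEvent ends a₁ a₂ a₃) -
              prob p (TEvent ends a₁ a₂ a₃ ∩ connEvent ends a₁ b) *
                prob p (avoidAll ends a₂ {a₁}))) := by
  unfold GammaLc SL DEF EQo EQ3 EQ3o Do
  simp only [prob_R_eq p ends a₁ a₂ a₃, prob_R_univ p ends a₁ a₂ a₃, Qsplit p ends a₁ a₂ a₃,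
    Qsplit_univ p ends a₁ a₂ a₃]
  ring

omit [LinearOrder R] [IsStrictOrderedRing R] in
/-- **`ΓLc` through `Ξ = −1_{oH} + 1_T (1_{o∈U} − γ)`** (cleared):
`ΓLc = 2 {D [P(Q,bL) P(Q,oH) − P(Q) P(Q,bL,oH)] + P(Q) [D P(T,bL,o∈U) − D_o P(T,bL)] − P(Q,bL) [D P(T,o∈U) − D_o P(T)]}`. -/
theorem GammaLc_eq_T_form (p : E → R) (ends : E → Sym2 V) (o a₁ a₂ a₃ b : V) :
    GammaLc p ends o a₁ a₂ a₃ b =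
      2 * (prob p (PDEvent ends a₁ a₂ a₃) *
            (prob p (avoidAll ends a₂ {a₁} ∩ connEvent ends a₁ b) *
                prob p (avoidAll ends a₂ {a₁} ∩ connEvent ends a₂ o) -
              prob p (avoidAll ends a₂ {a₁}) *
                prob p (avoidAll ends a₂ {a₁} ∩ (connEvent ends a₂ o ∩ connEvent ends a₁ b))) +
          prob p (avoidAll ends a₂ {a₁}) *
            (prob p (PDEvent ends a₁ a₂ a₃) *
                (prob p (TEvent ends a₁ a₂ a₃ ∩ (connEvent ends a₁ o ∩ connEvent ends a₁ b)) +
                  prob p (TEvent ends a₁ a₂ a₃ ∩ (connEvent ends a₂ o ∩ connEvent ends a₁ b))) -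
              Do p ends o a₁ a₂ a₃ * prob p (TEvent ends a₁ a₂ a₃ ∩ connEvent ends a₁ b)) -
          prob p (avoidAll ends a₂ {a₁} ∩ connEvent ends a₁ b) *
            (prob p (PDEvent ends a₁ a₂ a₃) *
                (prob p (TEvent ends a₁ a₂ a₃ ∩ connEvent ends a₁ o) +
                  prob p (TEvent ends a₁ a₂ a₃ ∩ connEvent ends a₂ o)) -
              Do p ends o a₁ a₂ a₃ * prob p (TEvent ends a₁ a₂ a₃))) := by
  unfold GammaLc DEF EQo EQ3 EQ3o Do
  simp only [Qsplit p ends a₁ a₂ a₃, Qsplit_univ p ends a₁ a₂ a₃]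
  ring

end Identities

section Facts

variable {V : Type*} {E : Type*} [Fintype E] [DecidableEq E] [Fintype V] [DecidableEq V]
  {R : Type*} [Field R] [LinearOrder R] [IsStrictOrderedRing R]

omit [Fintype E] [DecidableEq E] [Fintype V] [DecidableEq V] [LinearOrder R]
  [IsStrictOrderedRing R] in
/-- `{bL} ∩ {a₃ ∈ H} ∩ Q = T ∩ {bL}`. -/
lemma bL_inter_a3H_inter_Q (ends : E → Sym2 V) (a₁ a₂ a₃ b : V) :
    connEvent ends a₁ b ∩ connEvent ends a₂ a₃ ∩ avoidAll ends a₂ {a₁} =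
      TEvent ends a₁ a₂ a₃ ∩ connEvent ends a₁ b := by
  rw [TypeRB.H_eq]
  ext ω
  simp only [Set.mem_inter_iff]
  tauto

omit [Fintype E] [DecidableEq E] [Fintype V] [DecidableEq V] [LinearOrder R]
  [IsStrictOrderedRing R] in
/-- `{a₃ ∈ H} ∩ Q = T`. -/
lemma a3H_inter_Q (ends : E → Sym2 V) (a₁ a₂ a₃ : V) :
    connEvent ends a₂ a₃ ∩ avoidAll ends a₂ {a₁} = TEvent ends a₁ a₂ a₃ := by
  rw [TypeRB.H_eq, Set.inter_comm]

/-- **BHK cross-cluster for `bL` and `a₃ ∈ H`**: `P(T,bL) P(Q) ≤ P(Q,bL) P(T)`. -/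
lemma TbL_mul_Q_le (p : E → R) (hp : IsProbVec p) (ends : E → Sym2 V) (a₁ a₂ a₃ b : V) :
    prob p (TEvent ends a₁ a₂ a₃ ∩ connEvent ends a₁ b) * prob p (avoidAll ends a₂ {a₁}) ≤
      prob p (avoidAll ends a₂ {a₁} ∩ connEvent ends a₁ b) * prob p (TEvent ends a₁ a₂ a₃) := by
  have h := bhk_cross_cluster p hp ends a₁ a₂ (isUpperSet_mem_setOf b) (isUpperSet_mem_setOf a₃)
  rw [← connEvent_eq_clusterInEvent ends a₁ b, ← connEvent_eq_clusterInEvent ends a₂ a₃,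
    compl_conn_eq_avoidAll ends a₁ a₂, bL_inter_a3H_inter_Q, a3H_inter_Q,
    Set.inter_comm (connEvent ends a₁ b)] at h
  exact h

/-- **BHK cross-cluster for `bL` and `oH` on `Q`**: `P(Q,bL,oH) P(Q) ≤ P(Q,bL) P(Q,oH)`. -/
lemma QbLoH_mul_Q_le (p : E → R) (hp : IsProbVec p) (ends : E → Sym2 V) (o a₁ a₂ b : V) :
    prob p (avoidAll ends a₂ {a₁} ∩ (connEvent ends a₂ o ∩ connEvent ends a₁ b)) *
        prob p (avoidAll ends a₂ {a₁}) ≤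
      prob p (avoidAll ends a₂ {a₁} ∩ connEvent ends a₁ b) *
        prob p (avoidAll ends a₂ {a₁} ∩ connEvent ends a₂ o) := by
  have h := bhk_cross_cluster p hp ends a₁ a₂ (isUpperSet_mem_setOf b) (isUpperSet_mem_setOf o)
  rw [← connEvent_eq_clusterInEvent ends a₁ b, ← connEvent_eq_clusterInEvent ends a₂ o,
    compl_conn_eq_avoidAll ends a₁ a₂] at h
  have e1 : connEvent ends a₁ b ∩ connEvent ends a₂ o ∩ avoidAll ends a₂ {a₁} =
      avoidAll ends a₂ {a₁} ∩ (connEvent ends a₂ o ∩ connEvent ends a₁ b) := by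
    ext ω; simp only [Set.mem_inter_iff]; tauto
  have e2 : connEvent ends a₁ b ∩ avoidAll ends a₂ {a₁} =
      avoidAll ends a₂ {a₁} ∩ connEvent ends a₁ b := Set.inter_comm _ _
  have e3 : connEvent ends a₂ o ∩ avoidAll ends a₂ {a₁} =
      avoidAll ends a₂ {a₁} ∩ connEvent ends a₂ o := Set.inter_comm _ _
  rw [e1, e2, e3] at h
  exact h

/-- **The centring bracket is nonnegative** (`γ ≥ c₀`, cleared):
`0 ≤ D_o P(T) P(R) − D P(T,oL) P(R) − D P(R,oH) P(T)`, by `ToL_mul_D_le` and its root swap. -/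
lemma centring_bracket_nonneg (p : E → R) (hp : IsProbVec p) (ends : E → Sym2 V)
    (o a₁ a₂ a₃ : V) :
    0 ≤ Do p ends o a₁ a₂ a₃ * prob p (TEvent ends a₁ a₂ a₃) * prob p (avoidAll ends a₂ {a₁, a₃}) -
        prob p (PDEvent ends a₁ a₂ a₃) * prob p (TEvent ends a₁ a₂ a₃ ∩ connEvent ends a₁ o) *
          prob p (avoidAll ends a₂ {a₁, a₃}) -
        prob p (PDEvent ends a₁ a₂ a₃) * prob p (avoidAll ends a₂ {a₁, a₃} ∩ connEvent ends a₂ o) *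
          prob p (TEvent ends a₁ a₂ a₃) := by
  have h1 := ToL_mul_D_le p hp ends o a₁ a₂ a₃
  have h2 := ToL_mul_D_le p hp ends o a₂ a₁ a₃
  rw [PDEvent_root_swap] at h2
  have hD := prob_nonneg hp (PDEvent ends a₁ a₂ a₃)
  have hT := prob_nonneg hp (TEvent ends a₁ a₂ a₃)
  have hT' := prob_nonneg hp (TEvent ends a₂ a₁ a₃)
  rw [prob_R_univ p ends a₁ a₂ a₃, prob_R_eq p ends a₁ a₂ a₃]
  unfold Do
  have key : (prob p (PDEvent ends a₁ a₂ a₃ ∩ connEvent ends a₁ o) +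
        prob p (PDEvent ends a₁ a₂ a₃ ∩ connEvent ends a₂ o)) * prob p (TEvent ends a₁ a₂ a₃) *
        (prob p (PDEvent ends a₁ a₂ a₃) + prob p (TEvent ends a₂ a₁ a₃)) -
      prob p (PDEvent ends a₁ a₂ a₃) * prob p (TEvent ends a₁ a₂ a₃ ∩ connEvent ends a₁ o) *
        (prob p (PDEvent ends a₁ a₂ a₃) + prob p (TEvent ends a₂ a₁ a₃)) -
      prob p (PDEvent ends a₁ a₂ a₃) *
        (prob p (PDEvent ends a₁ a₂ a₃ ∩ connEvent ends a₂ o) +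
          prob p (TEvent ends a₂ a₁ a₃ ∩ connEvent ends a₂ o)) * prob p (TEvent ends a₁ a₂ a₃) =
      (prob p (PDEvent ends a₁ a₂ a₃) + prob p (TEvent ends a₂ a₁ a₃)) *
          (prob p (PDEvent ends a₁ a₂ a₃ ∩ connEvent ends a₁ o) * prob p (TEvent ends a₁ a₂ a₃) -
            prob p (TEvent ends a₁ a₂ a₃ ∩ connEvent ends a₁ o) * prob p (PDEvent ends a₁ a₂ a₃)) +
        prob p (TEvent ends a₁ a₂ a₃) *
          (prob p (PDEvent ends a₁ a₂ a₃ ∩ connEvent ends a₂ o) * prob p (TEvent ends a₂ a₁ a₃) -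
            prob p (TEvent ends a₂ a₁ a₃ ∩ connEvent ends a₂ o) * prob p (PDEvent ends a₁ a₂ a₃)) := by
    ring
  rw [key]
  exact add_nonneg (mul_nonneg (add_nonneg hD hT') (sub_nonneg.mpr h1))
    (mul_nonneg hT (sub_nonneg.mpr h2))

end Facts

section Reduction

variable {V : Type*} {E : Type*} [Fintype E] [DecidableEq E] [Fintype V] [DecidableEq V]
  {R : Type*} [Field R] [LinearOrder R] [IsStrictOrderedRing R]

/-- **`0 ≤ ΓLc` from SHARP-L** in the non-degenerate worlds `P(T), P(R) > 0`. -/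
theorem GammaLc_nonneg_of_SharpL (p : E → R) (hp : IsProbVec p) (ends : E → Sym2 V)
    (o a₁ a₂ a₃ b : V) (hT : 0 < prob p (TEvent ends a₁ a₂ a₃))
    (hR : 0 < prob p (avoidAll ends a₂ {a₁, a₃})) (h : SharpL p ends o a₁ a₂ a₃ b) :
    0 ≤ GammaLc p ends o a₁ a₂ a₃ b := by
  have hid := sharp_identity p ends o a₁ a₂ a₃ b
  have hF1 := TbL_mul_Q_le p hp ends a₁ a₂ a₃ b
  have hF2 := centring_bracket_nonneg p hp ends o a₁ a₂ a₃
  have hD := prob_nonneg hp (PDEvent ends a₁ a₂ a₃)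
  have hQ := prob_nonneg hp (avoidAll ends a₂ {a₁})
  unfold SharpL at h
  have hpos : 0 ≤ prob p (TEvent ends a₁ a₂ a₃) * prob p (avoidAll ends a₂ {a₁, a₃}) *
      GammaLc p ends o a₁ a₂ a₃ b := by
    rw [hid]
    have h3 := mul_nonneg (mul_nonneg hD hQ) h
    have h4 := mul_nonneg hF2 (sub_nonneg.mpr hF1)
    linarith
  exact (mul_nonneg_iff_of_pos_left (mul_pos hT hR)).1 hpos

/-- **`0 ≤ ΓLc` when `P(T) = 0`**: then `Ξ = −1_{oH}` and the half is the `bhk_cross_cluster`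
slack `2 D [P(Q,bL) P(Q,oH) − P(Q) P(Q,bL,oH)]`. -/
theorem GammaLc_nonneg_of_T_null (p : E → R) (hp : IsProbVec p) (ends : E → Sym2 V)
    (o a₁ a₂ a₃ b : V) (hT : prob p (TEvent ends a₁ a₂ a₃) = 0) :
    0 ≤ GammaLc p ends o a₁ a₂ a₃ b := by
  rw [GammaLc_eq_T_form]
  have z : ∀ X : Set (Config E), prob p (TEvent ends a₁ a₂ a₃ ∩ X) = 0 := fun X =>
    le_antisymm (hT ▸ prob_mono hp Set.inter_subset_left) (prob_nonneg hp _)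
  simp only [z, hT, mul_zero, add_zero, sub_zero, sub_self]
  have h := QbLoH_mul_Q_le p hp ends o a₁ a₂ b
  have hD := prob_nonneg hp (PDEvent ends a₁ a₂ a₃)
  have h2 : 0 ≤ prob p (avoidAll ends a₂ {a₁} ∩ connEvent ends a₁ b) *
      prob p (avoidAll ends a₂ {a₁} ∩ connEvent ends a₂ o) -
      prob p (avoidAll ends a₂ {a₁}) *
        prob p (avoidAll ends a₂ {a₁} ∩ (connEvent ends a₂ o ∩ connEvent ends a₁ b)) := by
    linarith
  nlinarith [mul_nonneg hD h2]

omit [Fintype V] in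
/-- **`ΓLc = 0` when `P(R) = 0`**: then `D = 0` (`PD ⊆ R`) and every term of `ΓLc` carries `D`,
`D_o` or `D E_Q[F]`. -/
theorem GammaLc_eq_zero_of_R_null (p : E → R) (hp : IsProbVec p) (ends : E → Sym2 V)
    (o a₁ a₂ a₃ b : V) (hR : prob p (avoidAll ends a₂ {a₁, a₃}) = 0) :
    GammaLc p ends o a₁ a₂ a₃ b = 0 := by
  have hPD : PDEvent ends a₁ a₂ a₃ ⊆ avoidAll ends a₂ {a₁, a₃} := by
    rw [← PDEvent_root_swap, ISplit.PD_eq_R_inter]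
    exact Set.inter_subset_left
  have hD : prob p (PDEvent ends a₁ a₂ a₃) = 0 :=
    le_antisymm (hR ▸ prob_mono hp hPD) (prob_nonneg hp _)
  have z : ∀ X : Set (Config E), prob p (PDEvent ends a₁ a₂ a₃ ∩ X) = 0 := fun X =>
    le_antisymm (hD ▸ prob_mono hp Set.inter_subset_left) (prob_nonneg hp _)
  unfold GammaLc DEF Do
  simp only [z, hD, mul_zero, zero_mul, add_zero, sub_self]

/-- **`0 ≤ ΓLc` from SHARP-L**, every instance (the degenerate worlds included). -/
theorem GammaLc_nonneg (p : E → R) (hp : IsProbVec p) (ends : E → Sym2 V) (o a₁ a₂ a₃ b : V)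
    (h : SharpL p ends o a₁ a₂ a₃ b) : 0 ≤ GammaLc p ends o a₁ a₂ a₃ b := by
  rcases (prob_nonneg hp (TEvent ends a₁ a₂ a₃)).lt_or_eq with hT | hT
  · rcases (prob_nonneg hp (avoidAll ends a₂ {a₁, a₃})).lt_or_eq with hR | hR
    · exact GammaLc_nonneg_of_SharpL p hp ends o a₁ a₂ a₃ b hT hR h
    · rw [GammaLc_eq_zero_of_R_null p hp ends o a₁ a₂ a₃ b hR.symm]
  · exact GammaLc_nonneg_of_T_null p hp ends o a₁ a₂ a₃ b hT.symm

/-- **(HCOV) ⟸ SHARP-L ∧ SHARP-H** for every labelled instance (SHARP-H = SHARP-L with the roots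
exchanged). -/
theorem HCov_of_SharpL_SharpH (p : E → R) (hp : IsProbVec p) (ends : E → Sym2 V)
    (o a₁ a₂ a₃ b : V) (hL : SharpL p ends o a₁ a₂ a₃ b) (hH : SharpL p ends o a₂ a₁ a₃ b) :
    HCov p ends o a₁ a₂ a₃ b := by
  unfold HCov
  rw [Gc_eq_halves, GammaHc_eq_swap]
  exact add_nonneg (GammaLc_nonneg p hp ends o a₁ a₂ a₃ b hL)
    (GammaLc_nonneg p hp ends o a₂ a₁ a₃ b hH)

end Reduction

section ClosureChain

variable (R : Type*) [Field R] [LinearOrder R] [IsStrictOrderedRing R]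

/-- **The closure form: `HCov_all ⟸ SharpL_all`.** -/
theorem HCov_all_of_SharpL_all (h : SharpL_all R) : HCov_all R := by
  intro V E _ _ _ _ ends p hp o a₁ a₂ a₃ b h12 h13 h23 ho1 ho2 ho3 hob hb1 hb2 hb3
  exact HCov_of_SharpL_SharpH p hp ends o a₁ a₂ a₃ b
    (h V E ends p hp o a₁ a₂ a₃ b h12 h13 h23 ho1 ho2 ho3 hob hb1 hb2 hb3)
    (h V E ends p hp o a₂ a₁ a₃ b h12.symm h23 h13 ho2 ho1 ho3 hob hb2 hb1 hb3)

end ClosureChain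

end SharpHalves

end Summit.Ventures.PercRepro2
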